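import Literature.Probability.Percolation.OrbitLoopCloseness
import Literature.Probability.Percolation.MedialGridDistances
import Literature.Probability.Percolation.FKLoopWindingCells
import Literature.Topology.PlaneTopology.JordanSweepParity
import HarnessLib

/-!
# The rounded loop of an interface loop: sharp closeness and equal winding numbers at lattice points

Topic `Literature/Probability/Percolation`; proofs only. Continuation of `OrbitLoopCloseness.lean`
(the rounded Jordan loop `OrbitPolygon.loop ω p δ` of the orbit of a corner `p` under Smirnov's
turning rule, Smirnov C. R. Acad. Sci. 333 (2001) §2; Camia–Newman CMP 268 (2006) §2):

* `dartPt_srcDir_eq`, `dartPt_tgtDir_eq` — the shifted side points of a dart are the quarter and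
  three-quarter points of the medial dart segment; `OrbitPolygon.pS_eq`, `OrbitPolygon.pT_eq`;
* `IsInterfaceLoop.dist_closedCurve_loop_le_sharp` — at equal times the uniformly parametrised
  medial polygon (`closedCurve`, class `loopCurve δ 0 γ`) and the rounded loop are within
  `(√2/8)δ` (the tree's `dist_closedCurve_loop_le` gives `4δ`), which is less than the clearance
  `(√2/4)δ` of the medial polygon from lattice vertices and face centres;
* `IsInterfaceLoop.wind_loop_sub_eq` — hence (dog-on-a-leash) the rounded loop and the medial
  polygon have the same winding number around every point at distance `≥ (√2/4)δ` from the polygon,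
  and such points are off the rounded loop (`not_mem_range_loop`);
* for the orbit loop `orbitLoop ω q`: `wind_loop_sub_meshPoint`, `wind_loop_sub_faceCenter`, and
  the Jordan reading `meshPoint_mem_inside_loop_iff`, `faceCenter_mem_inside_loop_iff`
  (+ `outside` versions): a lattice vertex / face centre is inside the rounded loop iff the medial
  polygon winds around it (`IsJordanLoop.mem_inside_iff_wind_ne_zero`).

This is the dictionary through which the cluster-side winding API of interface loops
(`InterfaceLoopClusters.lean`) is applied to the Jordan curve `OrbitPolygon.loop` in planar
separation arguments (sub-arcs of interface loops between a primal and a dual crossing).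

## References

* F. Camia, C. M. Newman, Comm. Math. Phys. 268 (2006), §2 [CamiaNewman2006].
* S. Smirnov, C. R. Acad. Sci. Paris 333 (2001), §2 [Smirnov2001].
-/

noncomputable section

namespace Literature.Probability.LatticeModels

open Complex

/-- **The shifted source point is the quarter point of the medial dart**:
`dartPt v f (srcDir v f) = ¾·m(cornerSource) + ¼·m(cornerTarget)`. [folklore] -/
theorem dartPt_srcDir_eq {v f : Site 2} (h : IsCorner v f) :
    dartPt v f (srcDir v f) =
      (3 / 4 : ℂ) * medialPoint 1 (cornerSource v f) + (1 / 4 : ℂ) * medialPoint 1 (cornerTarget v f) := by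
  rcases h 0 with h0 | h0 <;> rcases h 1 with h1 | h1 <;>
  · apply Complex.ext <;>
      simp [dartPt, srcDir, toward, inward, cornerSource, cornerTarget, cornerEdge, cornerNeighbor,
        meshPoint, h0, h1] <;> ring

/-- **The shifted target point is the three-quarter point of the medial dart**:
`dartPt v f (tgtDir v f) = ¼·m(cornerSource) + ¾·m(cornerTarget)`. [folklore] -/
theorem dartPt_tgtDir_eq {v f : Site 2} (h : IsCorner v f) :
    dartPt v f (tgtDir v f) =
      (1 / 4 : ℂ) * medialPoint 1 (cornerSource v f) + (3 / 4 : ℂ) * medialPoint 1 (cornerTarget v f) := by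
  rcases h 0 with h0 | h0 <;> rcases h 1 with h1 | h1 <;>
  · apply Complex.ext <;>
      simp [dartPt, tgtDir, toward, inward, cornerSource, cornerTarget, cornerEdge, cornerNeighbor,
        meshPoint, h0, h1] <;> ring

/-- **The medial dart has length `√2/2`** (mesh `1`). [folklore] -/
theorem norm_medialPoint_cornerTarget_sub_cornerSource {v f : Site 2} (h : IsCorner v f) :
    ‖medialPoint 1 (cornerTarget v f) - medialPoint 1 (cornerSource v f)‖ = Real.sqrt 2 / 2 := by
  have hsq : ‖medialPoint 1 (cornerTarget v f) - medialPoint 1 (cornerSource v f)‖ ^ 2 = 1 / 2 := by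
    rw [Complex.sq_norm, Complex.normSq_apply]
    rcases h 0 with h0 | h0 <;> rcases h 1 with h1 | h1 <;>
      (simp [cornerSource, cornerTarget, cornerEdge, cornerNeighbor, meshPoint, h0, h1]; ring)
  have h2 : (Real.sqrt 2 / 2) ^ 2 = 1 / 2 := by
    rw [div_pow, Real.sq_sqrt (by norm_num : (0 : ℝ) ≤ 2)]; norm_num
  nlinarith [norm_nonneg (medialPoint 1 (cornerTarget v f) - medialPoint 1 (cornerSource v f)),
    Real.sqrt_nonneg 2, sq_nonneg (‖medialPoint 1 (cornerTarget v f) - medialPoint 1 (cornerSource v f)‖ - Real.sqrt 2 / 2)]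

end Literature.Probability.LatticeModels

namespace Literature.Probability.Percolation

open Set Function LatticeModels RandomPlanarGeometry

namespace OrbitPolygon

variable {β : BondConfig (Site 2)} {p : Site 2 × Fin 4}

/-- `pS` at mesh `δ` is the quarter point of the medial dart. [folklore] -/
theorem pS_eq (δ : ℝ) (j : ℕ) :
    pS β p δ j = (3 / 4 : ℂ) * medialPoint δ (cSrc (corner β p j)) + (1 / 4 : ℂ) * medialPoint δ (cTgt (corner β p j)) := by
  rw [pS, dartPt_srcDir_eq (isCorner j), cornerSource_eq, cornerTarget_eq, Complex.real_smul,
    medialPoint_eq_mul_one δ (cSrc _), medialPoint_eq_mul_one δ (cTgt _)]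
  ring

/-- `pT` at mesh `δ` is the three-quarter point of the medial dart. [folklore] -/
theorem pT_eq (δ : ℝ) (j : ℕ) :
    pT β p δ j = (1 / 4 : ℂ) * medialPoint δ (cSrc (corner β p j)) + (3 / 4 : ℂ) * medialPoint δ (cTgt (corner β p j)) := by
  rw [pT, dartPt_tgtDir_eq (isCorner j), cornerSource_eq, cornerTarget_eq, Complex.real_smul,
    medialPoint_eq_mul_one δ (cSrc _), medialPoint_eq_mul_one δ (cTgt _)]
  ring

/-- The medial dart of a corner of the orbit has length `(√2/2)·δ`. [folklore] -/
theorem norm_medialPoint_cTgt_sub_cSrc {δ : ℝ} (hδ : 0 ≤ δ) (j : ℕ) :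
    ‖medialPoint δ (cTgt (corner β p j)) - medialPoint δ (cSrc (corner β p j))‖ = Real.sqrt 2 / 2 * δ := by
  rw [medialPoint_eq_mul_one δ (cSrc _), medialPoint_eq_mul_one δ (cTgt _), ← mul_sub, norm_mul,
    Complex.norm_real, Real.norm_of_nonneg hδ, ← cornerSource_eq, ← cornerTarget_eq,
    norm_medialPoint_cornerTarget_sub_cornerSource (isCorner j)]
  ring

/-- The value of the rounded loop on `[0, 1)`. [folklore] -/
theorem loop_eq_interp {δ : ℝ} {t : ℝ} (ht : t ∈ Ico (0 : ℝ) 1) :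
    loop β p δ t = PLLoop.interp (vtx β p δ) ((2 * minimalPeriod (nextCorner β) p : ℕ) * t) := by
  simp only [loop, Function.comp_apply, Int.fract_eq_self.2 ht, PLLoop.unitLoop]

end OrbitPolygon

namespace IsInterfaceLoop

variable {ω : BondConfig (Site 2)} {γ : List MedialVertex}

/-- A convex combination of two vectors of norm `≤ r` has norm `≤ r`. [folklore] -/
theorem norm_convex_comb_le {a b : ℂ} {σ r : ℝ} (hσ0 : 0 ≤ σ) (hσ1 : σ ≤ 1) (ha : ‖a‖ ≤ r) (hb : ‖b‖ ≤ r) :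
    ‖((1 - σ : ℝ) : ℂ) * a + (σ : ℂ) * b‖ ≤ r := by
  calc ‖((1 - σ : ℝ) : ℂ) * a + (σ : ℂ) * b‖ ≤ ‖((1 - σ : ℝ) : ℂ) * a‖ + ‖(σ : ℂ) * b‖ := norm_add_le _ _
    _ = (1 - σ) * ‖a‖ + σ * ‖b‖ := by
        rw [norm_mul, norm_mul, Complex.norm_real, Complex.norm_real, Real.norm_of_nonneg (by linarith),
          Real.norm_of_nonneg hσ0]
    _ ≤ (1 - σ) * r + σ * r :=
        add_le_add (mul_le_mul_of_nonneg_left ha (by linarith)) (mul_le_mul_of_nonneg_left hb hσ0)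
    _ = r := by ring

/-- **The rounded loop is `(√2/8)δ`-close to the medial polygon, at equal times** (sharp form of
`dist_closedCurve_loop_le`): on the dart-piece phase of dart `k` both curves run along the dart and
differ by exactly a quarter of it; on the connector phase the difference moves affinely from a
quarter of dart `k` to a quarter of dart `k + 1`. In particular the distance is `< (√2/4)δ`, the
distance from the medial polygon to the lattice vertices and face centres. [cite: CamiaNewman2006, §2] -/
theorem dist_closedCurve_loop_le_sharp (h : IsInterfaceLoop ω γ) {p : Site 2 × Fin 4}
    (hps : cSrc p = γ[0 % γ.length]'(Nat.mod_lt _ h.length_pos))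
    (hpt : cTgt p = γ[(0 + 1) % γ.length]'(Nat.mod_lt _ h.length_pos)) {δ : ℝ} (hδ : 0 ≤ δ)
    (t : unitInterval) :
    dist (closedCurve (γ.map (medialPoint δ)) t) (OrbitPolygon.loop ω p δ t) ≤ Real.sqrt 2 / 8 * δ := by
  have hQ := h.minimalPeriod_eq_length hps hpt
  have hn : γ.map (medialPoint δ) ≠ [] := by simpa using h.ne_nil
  have hlen : (γ.map (medialPoint δ)).length = γ.length := List.length_map _
  -- reduce `t = 1` to `t = 0`
  wlog ht1 : (t : ℝ) < 1 generalizing t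
  · have ht : t = 1 := le_antisymm t.2.2 (not_lt.1 ht1)
    have h0 := this 0 (by norm_num)
    rw [ht]
    have hc : closedCurve (γ.map (medialPoint δ)) 1 = closedCurve (γ.map (medialPoint δ)) 0 :=
      ((isLoop_closedCurve _).symm : _)
    have hl : OrbitPolygon.loop ω p δ (1 : unitInterval) = OrbitPolygon.loop ω p δ (0 : unitInterval) := by
      have := OrbitPolygon.periodic_loop (β := ω) (p := p) δ 0
      simpa using this
    rwa [hc, hl]
  have ht : (t : ℝ) ∈ Ico (0 : ℝ) 1 := ⟨t.2.1, ht1⟩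
  set N := γ.length with hN
  have hNpos : 0 < N := h.length_pos
  have hNr : (0 : ℝ) < N := by exact_mod_cast hNpos
  -- indices
  set m := ⌊((2 * minimalPeriod (nextCorner ω) p : ℕ) : ℝ) * t⌋₊ with hm
  set k := m / 2 with hk
  have h2 : ((2 * minimalPeriod (nextCorner ω) p : ℕ) : ℝ) * t = 2 * ((N : ℝ) * t) := by
    rw [hQ]; push_cast; ring
  have hnn : 0 ≤ ((2 * minimalPeriod (nextCorner ω) p : ℕ) : ℝ) * t := mul_nonneg (Nat.cast_nonneg _) ht.1
  have hfl := Nat.floor_le hnn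
  have hflt := Nat.lt_floor_add_one (((2 * minimalPeriod (nextCorner ω) p : ℕ) : ℝ) * t)
  rw [← hm] at hfl hflt
  have hmI : ((2 * minimalPeriod (nextCorner ω) p : ℕ) : ℝ) * t ∈ Ico (m : ℝ) (m + 1) := ⟨hfl, hflt⟩
  rw [h2] at hfl hflt
  have hkt : (N : ℝ) * t ∈ Icc (k : ℝ) (k + 1) := by
    have hk1 : (2 * k : ℝ) ≤ m := by exact_mod_cast (show 2 * k ≤ m by omega)
    have hk2 : (m : ℝ) ≤ 2 * k + 1 := by exact_mod_cast (show m ≤ 2 * k + 1 by omega)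
    constructor <;> linarith
  have hkN : k < N := by
    have : (k : ℝ) ≤ N * t := hkt.1
    have hlt : (N : ℝ) * t < N := by nlinarith [ht.2]
    exact_mod_cast this.trans_lt hlt
  -- the polygon point
  have hcorner : ∀ j (hj : j < N), γ[j]'hj = cSrc (OrbitPolygon.corner ω p j) := by
    intro j hj
    have := h.getElem_eq_cSrc_iterate hNpos hps hpt hj
    rw [this, OrbitPolygon.corner]
    congr 2
    rw [Nat.sub_zero, Nat.add_mod_right, Nat.mod_eq_of_lt hj]
  set mS : ℂ := medialPoint δ (cSrc (OrbitPolygon.corner ω p k)) with hmS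
  set mT : ℂ := medialPoint δ (cTgt (OrbitPolygon.corner ω p k)) with hmT
  set mT' : ℂ := medialPoint δ (cTgt (OrbitPolygon.corner ω p (k + 1))) with hmT'
  have hsrc : (γ.map (medialPoint δ))[k % (γ.map (medialPoint δ)).length]'(Nat.mod_lt _ (by omega)) = mS := by
    simp only [List.getElem_map, hlen, Nat.mod_eq_of_lt hkN, hcorner k hkN, hmS]
  have htgt : (γ.map (medialPoint δ))[(k + 1) % (γ.map (medialPoint δ)).length]'(Nat.mod_lt _ (by omega)) = mT := by
    simp only [List.getElem_map, hlen]
    rw [hcorner _ (Nat.mod_lt _ hNpos), hmT, ← cSrc_nextCorner, ← OrbitPolygon.corner_succ,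
      OrbitPolygon.corner, OrbitPolygon.corner, ← hQ, iterate_mod_minimalPeriod_eq]
  have hk': k < (γ.map (medialPoint δ)).length := by rw [hlen]; exact hkN
  set τ : ℝ := (N : ℝ) * t - k with hτ
  have hpoly : closedCurve (γ.map (medialPoint δ)) t = mS + (τ : ℂ) * (mT - mS) := by
    rw [closedCurve_apply hn, hlen, affineInterp_closed_eq_lineMap hn hk' hkt, hsrc, htgt,
      AffineMap.lineMap_apply_module', Complex.real_smul]
    ring
  -- the quarter-dart vectors have norm `(√2/8)δ`
  have hq : ‖(1 / 4 : ℂ) * (mT - mS)‖ = Real.sqrt 2 / 8 * δ := by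
    rw [norm_mul, hmT, hmS, OrbitPolygon.norm_medialPoint_cTgt_sub_cSrc hδ]; norm_num; ring
  have hq' : ‖(1 / 4 : ℂ) * (mT' - mT)‖ = Real.sqrt 2 / 8 * δ := by
    have : mT = medialPoint δ (cSrc (OrbitPolygon.corner ω p (k + 1))) := by
      rw [hmT, OrbitPolygon.corner_succ, cSrc_nextCorner]
    rw [norm_mul, hmT', this, OrbitPolygon.norm_medialPoint_cTgt_sub_cSrc hδ]; norm_num; ring
  -- the rounded loop point
  rw [OrbitPolygon.loop_eq_interp ht, PLLoop.interp_of_mem_Ico hmI, dist_eq_norm']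
  obtain ⟨i, hi2 | hi2⟩ := Nat.even_or_odd' m
  · -- dart-piece phase: `m = 2i`, `i = k`, `τ ∈ [0, 1/2)`
    have hik : k = i := by rw [hk, hi2]; omega
    rw [hi2, OrbitPolygon.vtx_two_mul, OrbitPolygon.vtx_two_mul_add_one, ← hik, OrbitPolygon.pS_eq,
      OrbitPolygon.pT_eq, ← hmS, ← hmT, hpoly, h2]
    have e1 : (((2 * ((N : ℝ) * t) - ((2 * k : ℕ) : ℝ) : ℝ) : ℂ)) = 2 * (τ : ℂ) := by
      rw [hτ]; push_cast; ring
    rw [e1]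
    have e : (3 / 4 : ℂ) * mS + 1 / 4 * mT + 2 * (τ : ℂ) * ((1 / 4 : ℂ) * mS + 3 / 4 * mT - ((3 / 4 : ℂ) * mS + 1 / 4 * mT)) -
        (mS + (τ : ℂ) * (mT - mS)) = (1 / 4 : ℂ) * (mT - mS) := by ring
    rw [e, hq]
  · -- connector phase: `m = 2i + 1`, `i = k`, `τ ∈ [1/2, 1)`
    have hik : k = i := by rw [hk, hi2]; omega
    rw [hi2, OrbitPolygon.vtx_two_mul_add_one, show 2 * i + 1 + 1 = 2 * (i + 1) by ring,
      OrbitPolygon.vtx_two_mul, ← hik, OrbitPolygon.pS_eq, OrbitPolygon.pT_eq, ← hmS, ← hmT, ← hmT', hpoly, h2]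
    have hS' : medialPoint δ (cSrc (OrbitPolygon.corner ω p (k + 1))) = mT := by
      rw [hmT, OrbitPolygon.corner_succ, cSrc_nextCorner]
    rw [hS']
    set σ : ℝ := 2 * τ - 1 with hσ
    have hσ0 : 0 ≤ σ := by
      have : ((m : ℕ) : ℝ) ≤ 2 * ((N : ℝ) * t) := hfl
      rw [hi2] at this
      rw [hσ, hτ, hik]; push_cast at this ⊢; linarith
    have hσ1 : σ ≤ 1 := by
      have := hkt.2
      rw [hσ, hτ]; linarith
    have eτ : (τ : ℂ) = (((1 + σ) / 2 : ℝ) : ℂ) := by rw [hσ]; push_cast; ring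
    have eσ : (((2 * ((N : ℝ) * t) - ((2 * k + 1 : ℕ) : ℝ) : ℝ) : ℂ)) = (σ : ℂ) := by
      rw [hσ, hτ]; push_cast; ring
    rw [eσ, eτ]
    have e : (1 / 4 : ℂ) * mS + 3 / 4 * mT + (σ : ℂ) * ((3 / 4 : ℂ) * mT + 1 / 4 * mT' - ((1 / 4 : ℂ) * mS + 3 / 4 * mT)) -
        (mS + (((1 + σ) / 2 : ℝ) : ℂ) * (mT - mS)) =
        ((1 - σ : ℝ) : ℂ) * ((1 / 4 : ℂ) * (mT - mS)) + (σ : ℂ) * ((1 / 4 : ℂ) * (mT' - mT)) := by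
      push_cast; ring
    rw [e]
    exact norm_convex_comb_le hσ0 hσ1 hq.le hq'.le

/-- **Scaling of the clearance**: a point at distance `≥ √2/4` from the mesh-`1` polygon is, after
scaling by `δ > 0`, at distance `≥ (√2/4)δ` from the mesh-`δ` polygon. [folklore] -/
theorem le_infDist_range_loopCurve_mul (γ : List MedialVertex) {δ : ℝ} (hδ : 0 < δ) {z : ℂ} {a : ℝ}
    (hz : a ≤ Metric.infDist z (loopCurve 1 0 γ).range) :
    a * δ ≤ Metric.infDist ((δ : ℂ) * z) (loopCurve δ 0 γ).range := by
  rw [loopCurve_eq_map_mul, RandomPlanarGeometry.CurveClass.range_map]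
  refine (Metric.le_infDist ((RandomPlanarGeometry.CurveClass.range_nonempty _).image _)).2 fun y hy ↦ ?_
  obtain ⟨w, hw, rfl⟩ := hy
  have h1 := (Metric.le_infDist (RandomPlanarGeometry.CurveClass.range_nonempty _)).1 hz hw
  show a * δ ≤ dist ((δ : ℂ) * z) ((δ : ℂ) * w)
  rw [Complex.dist_eq, ← mul_sub, norm_mul, Complex.norm_real, Real.norm_of_nonneg hδ.le, ← Complex.dist_eq]
  nlinarith

/-- **The rounded loop and the medial polygon have the same winding number around every point at
distance `≥ (√2/4)δ` from the polygon** (dog-on-a-leash with the sharp closeness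
`dist_closedCurve_loop_le_sharp`); the hypothesis holds at all lattice vertices and face centres
(`le_infDist_meshPoint`, `le_infDist_faceCenter`). Here `wind` on the left is the winding number of
the `1`-periodic map `t ↦ loop t - z` read on `[0, 1]` (`Literature.Topology.PlaneTopology.wind`).
[cite: CamiaNewman2006, §2] -/
theorem wind_loop_sub_eq (h : IsInterfaceLoop ω γ) {p : Site 2 × Fin 4}
    (hps : cSrc p = γ[0 % γ.length]'(Nat.mod_lt _ h.length_pos))
    (hpt : cTgt p = γ[(0 + 1) % γ.length]'(Nat.mod_lt _ h.length_pos)) {δ : ℝ} (hδ : 0 < δ) {z : ℂ}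
    (hz : Real.sqrt 2 / 4 * δ ≤ Metric.infDist z (loopCurve δ 0 γ).range) :
    Literature.Topology.PlaneTopology.wind (fun t ↦ OrbitPolygon.loop ω p δ t - z) = (loopCurve δ 0 γ).wind z := by
  rw [loopCurve_zero_eq_mk_closedCurve] at hz ⊢
  rw [RandomPlanarGeometry.CurveClass.wind_mk, RandomPlanarGeometry.Curve.wind]
  rw [RandomPlanarGeometry.CurveClass.range_mk] at hz
  have hpos : 0 < Real.sqrt 2 / 4 * δ := by positivity
  have hzr : z ∉ (closedCurve (γ.map (medialPoint δ))).range := fun hmem ↦ by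
    rw [Metric.infDist_zero_of_mem hmem] at hz
    linarith
  have hg := RandomPlanarGeometry.Curve.isNonvanishingLoop_subPt (isLoop_closedCurve (γ.map (medialPoint δ))) hzr
  refine Literature.Topology.PlaneTopology.wind_eq_of_norm_sub_lt
    ((OrbitPolygon.continuous_loop.sub continuous_const).continuousOn) ?_ hg fun t ht ↦ ?_
  · have := OrbitPolygon.periodic_loop (β := ω) (p := p) δ 0
    simp only [zero_add] at this
    rw [this]
  · rw [RandomPlanarGeometry.Curve.subPt_of_mem _ z ht]
    have h1 := h.dist_closedCurve_loop_le_sharp hps hpt hδ.le ⟨t, ht⟩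
    rw [dist_eq_norm'] at h1
    have h2 : Real.sqrt 2 / 4 * δ ≤ ‖closedCurve (γ.map (medialPoint δ)) ⟨t, ht⟩ - z‖ := by
      rw [← dist_eq_norm, dist_comm]
      exact hz.trans (Metric.infDist_le_dist_of_mem ⟨_, rfl⟩)
    calc ‖OrbitPolygon.loop ω p δ t - z - (closedCurve (γ.map (medialPoint δ)) ⟨t, ht⟩ - z)‖
        = ‖OrbitPolygon.loop ω p δ t - closedCurve (γ.map (medialPoint δ)) ⟨t, ht⟩‖ := by congr 1; ring
      _ ≤ Real.sqrt 2 / 8 * δ := h1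
      _ < Real.sqrt 2 / 4 * δ := by nlinarith [Real.sqrt_pos.2 (show (0 : ℝ) < 2 by norm_num)]
      _ ≤ _ := h2

/-- Points at distance `≥ (√2/4)δ` from the medial polygon are off the rounded loop. [folklore] -/
theorem not_mem_range_loop (h : IsInterfaceLoop ω γ) {p : Site 2 × Fin 4}
    (hps : cSrc p = γ[0 % γ.length]'(Nat.mod_lt _ h.length_pos))
    (hpt : cTgt p = γ[(0 + 1) % γ.length]'(Nat.mod_lt _ h.length_pos)) {δ : ℝ} (hδ : 0 < δ) {z : ℂ}
    (hz : Real.sqrt 2 / 4 * δ ≤ Metric.infDist z (loopCurve δ 0 γ).range) :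
    z ∉ range (OrbitPolygon.loop ω p δ) := by
  rintro ⟨s, hs⟩
  -- read the time modulo `1`
  have hper := OrbitPolygon.periodic_loop (β := ω) (p := p) δ
  set t := Int.fract s with ht
  have htI : t ∈ Icc (0 : ℝ) 1 := ⟨Int.fract_nonneg s, (Int.fract_lt_one s).le⟩
  have hst : OrbitPolygon.loop ω p δ t = z := by
    rw [← hs, ht, Int.fract, show (s - ⌊s⌋ : ℝ) = s - (⌊s⌋ : ℤ) * (1 : ℝ) by ring, hper.sub_int_mul_eq]
  rw [loopCurve_zero_eq_mk_closedCurve, RandomPlanarGeometry.CurveClass.range_mk] at hz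
  have h1 := h.dist_closedCurve_loop_le_sharp hps hpt hδ.le ⟨t, htI⟩
  rw [hst] at h1
  have h2 : Real.sqrt 2 / 4 * δ ≤ dist (closedCurve (γ.map (medialPoint δ)) ⟨t, htI⟩) z := by
    rw [dist_comm]; exact hz.trans (Metric.infDist_le_dist_of_mem ⟨_, rfl⟩)
  nlinarith [Real.sqrt_pos.2 (show (0 : ℝ) < 2 by norm_num)]

end IsInterfaceLoop

/-! ### Lattice vertices and face centres versus the rounded loop of an orbit -/

section Orbit

variable {ω : BondConfig (Site 2)} {q : Site 2 × Fin 4}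

/-- The orbit loop starts with the dart of `q`. [cite: Smirnov2001, §2] -/
theorem cSrc_eq_getElem_orbitLoop_zero (hq : q ∈ periodicPts (nextCorner ω)) :
    cSrc q = (orbitLoop ω q)[0 % (orbitLoop ω q).length]'(Nat.mod_lt _ (isInterfaceLoop_orbitLoop hq).length_pos) := by
  simp [getElem_orbitLoop]

/-- The orbit loop's second medial vertex is the target edge of `q`. [cite: Smirnov2001, §2] -/
theorem cTgt_eq_getElem_orbitLoop_one (hq : q ∈ periodicPts (nextCorner ω)) :
    cTgt q = (orbitLoop ω q)[(0 + 1) % (orbitLoop ω q).length]'(Nat.mod_lt _ (isInterfaceLoop_orbitLoop hq).length_pos) := by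
  have hQ : 0 < minimalPeriod (nextCorner ω) q := minimalPeriod_pos_of_mem_periodicPts hq
  simp only [getElem_orbitLoop, zero_add, length_orbitLoop]
  rw [← cSrc_nextCorner]
  congr 1
  rcases Nat.lt_or_ge 1 (minimalPeriod (nextCorner ω) q) with h1 | h1
  · rw [Nat.mod_eq_of_lt h1, Function.iterate_one]
  · have h2 : minimalPeriod (nextCorner ω) q = 1 := by omega
    have h3 : (nextCorner ω)^[minimalPeriod (nextCorner ω) q] q = q := iterate_minimalPeriod
    rw [h2, Function.iterate_one] at h3
    rw [h2, Nat.mod_self, Function.iterate_zero, id_eq, h3]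

/-- Vertices at mesh `δ` are scaled mesh-`1` vertices. [folklore] -/
theorem meshPoint_eq_mul_one (δ : ℝ) (y : Site 2) : meshPoint δ y = (δ : ℂ) * meshPoint 1 y := by
  simp only [meshPoint]; push_cast; ring

/-- **The rounded loop of an orbit winds around a lattice vertex as the medial polygon does**
(mesh `δ`, read against the mesh-`1` winding number of the tree's API). [cite: CamiaNewman2006, §2] -/
theorem wind_loop_sub_meshPoint (hq : q ∈ periodicPts (nextCorner ω)) {δ : ℝ} (hδ : 0 < δ) (y : Site 2) :
    Literature.Topology.PlaneTopology.wind (fun t ↦ OrbitPolygon.loop ω q δ t - meshPoint δ y) =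
      (loopCurve 1 0 (orbitLoop ω q)).wind (meshPoint 1 y) := by
  have h := isInterfaceLoop_orbitLoop hq
  have hz := IsInterfaceLoop.le_infDist_range_loopCurve_mul (orbitLoop ω q) hδ (h.le_infDist_meshPoint y)
  rw [← meshPoint_eq_mul_one] at hz
  rw [h.wind_loop_sub_eq (cSrc_eq_getElem_orbitLoop_zero hq) (cTgt_eq_getElem_orbitLoop_one hq) hδ hz,
    wind_loopCurve_mesh hδ.ne', meshPoint_eq_mul_one δ y, mul_div_cancel_left₀ _ (by exact_mod_cast hδ.ne')]

/-- **The rounded loop of an orbit winds around a face centre as the medial polygon does.**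
[cite: CamiaNewman2006, §2] -/
theorem wind_loop_sub_faceCenter (hq : q ∈ periodicPts (nextCorner ω)) {δ : ℝ} (hδ : 0 < δ) (g : Site 2) :
    Literature.Topology.PlaneTopology.wind (fun t ↦ OrbitPolygon.loop ω q δ t - (δ : ℂ) * faceCenter g) =
      (loopCurve 1 0 (orbitLoop ω q)).wind (faceCenter g) := by
  have h := isInterfaceLoop_orbitLoop hq
  have hz := IsInterfaceLoop.le_infDist_range_loopCurve_mul (orbitLoop ω q) hδ (h.le_infDist_faceCenter g)
  rw [h.wind_loop_sub_eq (cSrc_eq_getElem_orbitLoop_zero hq) (cTgt_eq_getElem_orbitLoop_one hq) hδ hz,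
    wind_loopCurve_mesh hδ.ne', mul_div_cancel_left₀ _ (by exact_mod_cast hδ.ne')]

/-- Lattice vertices are off the rounded loop. [folklore] -/
theorem meshPoint_not_mem_range_loop (hq : q ∈ periodicPts (nextCorner ω)) {δ : ℝ} (hδ : 0 < δ) (y : Site 2) :
    meshPoint δ y ∉ range (OrbitPolygon.loop ω q δ) := by
  have h := isInterfaceLoop_orbitLoop hq
  have hz := IsInterfaceLoop.le_infDist_range_loopCurve_mul (orbitLoop ω q) hδ (h.le_infDist_meshPoint y)
  rw [← meshPoint_eq_mul_one] at hz
  exact h.not_mem_range_loop (cSrc_eq_getElem_orbitLoop_zero hq) (cTgt_eq_getElem_orbitLoop_one hq) hδ hz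

/-- Face centres are off the rounded loop. [folklore] -/
theorem faceCenter_not_mem_range_loop (hq : q ∈ periodicPts (nextCorner ω)) {δ : ℝ} (hδ : 0 < δ) (g : Site 2) :
    (δ : ℂ) * faceCenter g ∉ range (OrbitPolygon.loop ω q δ) := by
  have h := isInterfaceLoop_orbitLoop hq
  have hz := IsInterfaceLoop.le_infDist_range_loopCurve_mul (orbitLoop ω q) hδ (h.le_infDist_faceCenter g)
  exact h.not_mem_range_loop (cSrc_eq_getElem_orbitLoop_zero hq) (cTgt_eq_getElem_orbitLoop_one hq) hδ hz

/-- **A lattice vertex is inside the rounded loop of an orbit iff the medial polygon winds around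
it** (Jordan inside = non-zero winding number, `IsJordanLoop.mem_inside_iff_wind_ne_zero`).
[cite: CamiaNewman2006, §2] -/
theorem meshPoint_mem_inside_loop_iff (hq : q ∈ periodicPts (nextCorner ω)) {δ : ℝ} (hδ : 0 < δ) (y : Site 2) :
    meshPoint δ y ∈ Literature.Topology.PlaneTopology.IsJordanLoop.inside (OrbitPolygon.loop ω q δ) ↔
      (loopCurve 1 0 (orbitLoop ω q)).wind (meshPoint 1 y) ≠ 0 := by
  rw [(OrbitPolygon.isJordanLoop_loop hq hδ).mem_inside_iff_wind_ne_zero (meshPoint_not_mem_range_loop hq hδ y),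
    wind_loop_sub_meshPoint hq hδ y]

/-- **A face centre is inside the rounded loop of an orbit iff the medial polygon winds around it.**
[cite: CamiaNewman2006, §2] -/
theorem faceCenter_mem_inside_loop_iff (hq : q ∈ periodicPts (nextCorner ω)) {δ : ℝ} (hδ : 0 < δ) (g : Site 2) :
    (δ : ℂ) * faceCenter g ∈ Literature.Topology.PlaneTopology.IsJordanLoop.inside (OrbitPolygon.loop ω q δ) ↔
      (loopCurve 1 0 (orbitLoop ω q)).wind (faceCenter g) ≠ 0 := by
  rw [(OrbitPolygon.isJordanLoop_loop hq hδ).mem_inside_iff_wind_ne_zero (faceCenter_not_mem_range_loop hq hδ g),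
    wind_loop_sub_faceCenter hq hδ g]

/-- A lattice vertex is outside the rounded loop of an orbit iff the medial polygon does not wind
around it. [cite: CamiaNewman2006, §2] -/
theorem meshPoint_mem_outside_loop_iff (hq : q ∈ periodicPts (nextCorner ω)) {δ : ℝ} (hδ : 0 < δ) (y : Site 2) :
    meshPoint δ y ∈ Literature.Topology.PlaneTopology.IsJordanLoop.outside (OrbitPolygon.loop ω q δ) ↔
      (loopCurve 1 0 (orbitLoop ω q)).wind (meshPoint 1 y) = 0 := by
  rw [(OrbitPolygon.isJordanLoop_loop hq hδ).mem_outside_iff_wind_eq_zero (meshPoint_not_mem_range_loop hq hδ y),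
    wind_loop_sub_meshPoint hq hδ y]

/-- A face centre is outside the rounded loop of an orbit iff the medial polygon does not wind
around it. [cite: CamiaNewman2006, §2] -/
theorem faceCenter_mem_outside_loop_iff (hq : q ∈ periodicPts (nextCorner ω)) {δ : ℝ} (hδ : 0 < δ) (g : Site 2) :
    (δ : ℂ) * faceCenter g ∈ Literature.Topology.PlaneTopology.IsJordanLoop.outside (OrbitPolygon.loop ω q δ) ↔
      (loopCurve 1 0 (orbitLoop ω q)).wind (faceCenter g) = 0 := by
  rw [(OrbitPolygon.isJordanLoop_loop hq hδ).mem_outside_iff_wind_eq_zero (faceCenter_not_mem_range_loop hq hδ g),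
    wind_loop_sub_faceCenter hq hδ g]

end Orbit

end Literature.Probability.Percolation

end
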